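import Mathlib
import Literature.Analysis.FluidPDE.TaoCascadeNoLow
import Summits.NavierStokesRegularity.NavierStokesRegularity.Theorems.HeteroclinicTriggerChainTriggerChainFrontStepNormalForm
import HarnessLib

/-!
# `HeteroclinicTriggerChain` — crux `TriggerChainFrontStep` (item stmt-NavierStokesRegularity-22785):
  the cascade nonlinearity on CONNECTION-SHAPED families (row formulas)

Companion to the registered stub `stub_normal_form` (the normal form of a symmetric cancelling four-mode
table at a diagonal pure-mode saddle, tree file `…TriggerChainFrontStepNormalForm`). The (connection)
clause of the crux concerns an exact lattice family `H` supported on the four modes of shell `0` and on the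
receiver `(i₀, 1)`. For ANY family `X` with that support, the normal form together with the crux's
(parity) clause (every structure constant with an odd number of trigger slots `i₁` vanishes) evaluates
the nonlinearity `quadTerm 1 α X` in closed form on the rows that matter:

* carrier row `(i₀,0)`:   `quadTerm = -∑ⱼ d j 0 · X_{j,0}²`  (`= -e·u² + ∑_{junk} |d_j(0)|·X_j²`);
* receiver row `(i₀,1)`:  `quadTerm = ∑ⱼ α j j i₀ (0,0,1) · X_{j,0}²`  (diagonal pumps only);
* trigger row `(i₁,0)`:   `quadTerm = u · (d i₁ 0 · x - α i₁ i₁ i₀ (0,0,1) · y)` provided the trigger's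
  self-interaction feeds no junk mode (`α i₁ i₁ j (0,0,0) = 0` for `j ∉ {i₀,i₁}`);
* junk rows `(j,0)`, `(j,1)`, `j ∉ {i₀,i₁}`, on a junk-free family: `α i₁ i₁ j (0,0,0) · u²` and
  `α i₁ i₁ j (0,0,1) · u²`;
* the boundary cubic sums `topSum 1 α X (-1)` and `topSum 1 α X 1` vanish, so the total energy of the
  two shells is conserved along exact flows of this shape (`∑_{k<2} ∑ᵢ quadTerm·X = 0`);

These feed the analytic consequences of the (connection) clause (tree file `…ConnectionForm`, which
also carries the seed row of the table `σ`).

HONEST FRAMING: finite algebra of structure constants of Tao-type MODEL lattices (Tao 2016 §4); nothing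
here is a statement about the Navier–Stokes equations; no summit, rung or crux is proved by this file.
-/

noncomputable section

set_option linter.dupNamespace false

namespace Summit.NavierStokesRegularity.NavierStokesRegularity.Theorems

open Literature.Analysis.FluidPDE Literature.Analysis.FluidPDE.TaoCascade

/-- `(1+1)^{5·0/2} = 1` for the same-shell gain at shell `0` (integer shell cast to `ℝ`). [folklore] -/
theorem htcCA_gain_zero : (1 + 1 : ℝ) ^ ((5 : ℝ) * ((0 : ℤ) : ℝ) / 2) = 1 := by
  simp

/-- `(1+1)^{5·(1-1)/2} = 1` for the pump gain into shell `1`. [folklore] -/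
theorem htcCA_gain_one_sub_one : (1 + 1 : ℝ) ^ ((5 : ℝ) * (((1 : ℤ) : ℝ) - 1) / 2) = 1 := by
  simp

/-- **Carrier row.** For a table in normal form at the pure-mode saddle `δ_{(i₀,0)}` (symmetric,
cancelling, pure-`i₀` families force-free, diagonal polarisation with rate table `d`) and a family `X`
supported on shell `0` and the receiver `(i₀,1)`, the carrier feels only the diagonal drains:
`quadTerm 1 α X i₀ 0 t = -∑ⱼ d j 0 · X_{j,0}(t)²`. [this file] -/
theorem htcCA_quadTerm_carrier (α : Fin 4 → Fin 4 → Fin 4 → ℤ × ℤ × ℤ → ℝ) (i₀ : Fin 4)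
    (d : Fin 4 → ℤ → ℝ)
    (hsym : IsSymmetricCoeff α) (hcanc : IsCancellingCoeff α)
    (hpure : ∀ X : Fin 4 → ℤ → ℝ → ℝ, (∀ i n t, i ≠ i₀ → X i n t = 0) →
      ∀ i n t, quadTerm 1 α X i n t = 0)
    (hsad : ∀ (Y : Fin 4 → ℤ → ℝ → ℝ) (i : Fin 4) (n : ℤ) (t : ℝ),
      quadTerm 1 α (fun j m s => (fun j m (_ : ℝ) => if j = i₀ ∧ m = 0 then (1 : ℝ) else 0) j m s +
          Y j m s) i n t -
        quadTerm 1 α (fun j m (_ : ℝ) => if j = i₀ ∧ m = 0 then (1 : ℝ) else 0) i n t -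
        quadTerm 1 α Y i n t = d i n * Y i n t)
    (X : Fin 4 → ℤ → ℝ → ℝ) (t : ℝ) (hX : ∀ i n, n ≠ 0 → n ≠ 1 → X i n t = 0)
    (hX1 : ∀ i, i ≠ i₀ → X i 1 t = 0) :
    quadTerm 1 α X i₀ 0 t = -∑ j, d j 0 * X j 0 t ^ 2 := by
  obtain ⟨nf1, -, nf3, nf4, -, -, -, nf8, nf9⟩ :=
    HeteroclinicTriggerChain.stub_normal_form α i₀ d hsym hcanc hpure hsad
  rw [htcNF_quadTerm_expand, htcCA_gain_zero, one_mul]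
  have hpump : ∑ a : Fin 4, ∑ b : Fin 4, α a b i₀ (0, 0, 1) * (X a (0 - 1) t * X b (0 - 1) t) = 0 := by
    refine Finset.sum_eq_zero fun a _ => Finset.sum_eq_zero fun b _ => ?_
    rw [hX a (0 - 1) (by norm_num) (by norm_num), zero_mul, mul_zero]
  rw [hpump, mul_zero, add_zero]
  have hmain : ∀ a b : Fin 4,
      α a b i₀ (0, 0, 0) * (X a 0 t * X b 0 t) + α a b i₀ (1, 0, 0) * (X a (0 + 1) t * X b 0 t) +
        α a b i₀ (0, 1, 0) * (X a 0 t * X b (0 + 1) t) =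
      if b = a then -(d a 0) * X a 0 t ^ 2 else 0 := by
    intro a b
    rw [zero_add]
    -- back-reaction terms vanish
    have h2 : α a b i₀ (1, 0, 0) * (X a 1 t * X b 0 t) = 0 := by
      by_cases ha : a = i₀
      · rw [ha]
        by_cases hb : b = i₀
        · rw [hb, nf1 i₀ (1, 0, 0) (by decide), zero_mul]
        · rw [(nf3 b i₀ hb).2.2.1, zero_mul]
      · rw [hX1 a ha, zero_mul, mul_zero]
    have h3 : α a b i₀ (0, 1, 0) * (X a 0 t * X b 1 t) = 0 := by
      by_cases hb : b = i₀
      · rw [hb]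
        by_cases ha : a = i₀
        · rw [ha, nf1 i₀ (0, 1, 0) (by decide), zero_mul]
        · rw [(nf3 a i₀ ha).2.2.2, zero_mul]
      · rw [hX1 b hb, mul_zero, mul_zero]
    rw [h2, h3, add_zero, add_zero]
    by_cases hab : b = a
    · rw [hab, if_pos rfl, (nf9 a).1, nf4 a]
      ring
    · rw [if_neg hab, (nf8 a b (Ne.symm hab)).2, zero_mul]
  rw [Finset.sum_congr rfl fun a _ => Finset.sum_congr rfl fun b _ => hmain a b]
  simp only [Finset.sum_ite_eq', Finset.mem_univ, if_true]
  rw [← Finset.sum_neg_distrib]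
  refine Finset.sum_congr rfl fun a _ => ?_
  ring

/-- **Receiver row.** Same setting: the receiver `(i₀,1)` is fed only by the diagonal pumps of shell `0`:
`quadTerm 1 α X i₀ 1 t = ∑ⱼ α j j i₀ (0,0,1) · X_{j,0}(t)²`. [this file] -/
theorem htcCA_quadTerm_receiver (α : Fin 4 → Fin 4 → Fin 4 → ℤ × ℤ × ℤ → ℝ) (i₀ : Fin 4)
    (d : Fin 4 → ℤ → ℝ)
    (hsym : IsSymmetricCoeff α) (hcanc : IsCancellingCoeff α)
    (hpure : ∀ X : Fin 4 → ℤ → ℝ → ℝ, (∀ i n t, i ≠ i₀ → X i n t = 0) →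
      ∀ i n t, quadTerm 1 α X i n t = 0)
    (hsad : ∀ (Y : Fin 4 → ℤ → ℝ → ℝ) (i : Fin 4) (n : ℤ) (t : ℝ),
      quadTerm 1 α (fun j m s => (fun j m (_ : ℝ) => if j = i₀ ∧ m = 0 then (1 : ℝ) else 0) j m s +
          Y j m s) i n t -
        quadTerm 1 α (fun j m (_ : ℝ) => if j = i₀ ∧ m = 0 then (1 : ℝ) else 0) i n t -
        quadTerm 1 α Y i n t = d i n * Y i n t)
    (X : Fin 4 → ℤ → ℝ → ℝ) (t : ℝ) (hX : ∀ i n, n ≠ 0 → n ≠ 1 → X i n t = 0)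
    (hX1 : ∀ i, i ≠ i₀ → X i 1 t = 0) :
    quadTerm 1 α X i₀ 1 t = ∑ j, α j j i₀ (0, 0, 1) * X j 0 t ^ 2 := by
  obtain ⟨nf1, -, -, -, -, -, -, nf8, -⟩ :=
    HeteroclinicTriggerChain.stub_normal_form α i₀ d hsym hcanc hpure hsad
  rw [htcNF_quadTerm_expand, htcCA_gain_one_sub_one, one_mul]
  have htop : ∑ a : Fin 4, ∑ b : Fin 4,
      (α a b i₀ (0, 0, 0) * (X a 1 t * X b 1 t) + α a b i₀ (1, 0, 0) * (X a (1 + 1) t * X b 1 t) +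
        α a b i₀ (0, 1, 0) * (X a 1 t * X b (1 + 1) t)) = 0 := by
    refine Finset.sum_eq_zero fun a _ => Finset.sum_eq_zero fun b _ => ?_
    rw [hX a (1 + 1) (by norm_num) (by norm_num), hX b (1 + 1) (by norm_num) (by norm_num),
      zero_mul, mul_zero, mul_zero, mul_zero, add_zero, add_zero]
    by_cases ha : a = i₀
    · rw [ha]
      by_cases hb : b = i₀
      · rw [hb, nf1 i₀ (0, 0, 0) (by decide), zero_mul]
      · rw [hX1 b hb, mul_zero, mul_zero]
    · rw [hX1 a ha, zero_mul, mul_zero]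
  rw [htop, mul_zero, zero_add]
  have hmain : ∀ a b : Fin 4, α a b i₀ (0, 0, 1) * (X a (1 - 1) t * X b (1 - 1) t) =
      if b = a then α a a i₀ (0, 0, 1) * X a 0 t ^ 2 else 0 := by
    intro a b
    rw [sub_self]
    by_cases hab : b = a
    · rw [hab, if_pos rfl]; ring
    · rw [if_neg hab, (nf8 a b (Ne.symm hab)).1, zero_mul]
  rw [Finset.sum_congr rfl fun a _ => Finset.sum_congr rfl fun b _ => hmain a b]
  simp only [Finset.sum_ite_eq', Finset.mem_univ, if_true]


/-- A double sum over `Fin 4 × Fin 4` of a summand supported at ONE index pair. [folklore] -/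
theorem htcCA_sum_sum_ite_pair (a₀ b₀ : Fin 4) (c : ℝ) :
    ∑ a : Fin 4, ∑ b : Fin 4, (if a = a₀ ∧ b = b₀ then c else 0) = c := by
  rw [Finset.sum_eq_single a₀ (fun a _ ha => by simp [ha]) (by simp)]
  simp

/-- **Trigger row.** Same setting plus the (parity) clause for the trigger mode `i₁ ≠ i₀` and NO
trigger self-interaction into the junk modes (`α i₁ i₁ j (0,0,0) = 0` for `j ∉ {i₀, i₁}`): on a family
supported on shell `0` and the receiver, the trigger grows on the carrier and is quenched by the receiver,
`quadTerm 1 α X i₁ 0 t = u · (d i₁ 0 · x - α i₁ i₁ i₀ (0,0,1) · y)` (`x, u, y` = carrier, trigger,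
receiver amplitudes). [this file] -/
theorem htcCA_quadTerm_trigger (α : Fin 4 → Fin 4 → Fin 4 → ℤ × ℤ × ℤ → ℝ) (i₀ i₁ : Fin 4)
    (d : Fin 4 → ℤ → ℝ) (hne : i₀ ≠ i₁)
    (hsym : IsSymmetricCoeff α) (hcanc : IsCancellingCoeff α)
    (hpure : ∀ X : Fin 4 → ℤ → ℝ → ℝ, (∀ i n t, i ≠ i₀ → X i n t = 0) →
      ∀ i n t, quadTerm 1 α X i n t = 0)
    (hpar : ∀ (j₁ j₂ j₃ : Fin 4) (μ : ℤ × ℤ × ℤ), Xor (Xor (j₁ = i₁) (j₂ = i₁)) (j₃ = i₁) →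
      α j₁ j₂ j₃ μ = 0)
    (hsad : ∀ (Y : Fin 4 → ℤ → ℝ → ℝ) (i : Fin 4) (n : ℤ) (t : ℝ),
      quadTerm 1 α (fun j m s => (fun j m (_ : ℝ) => if j = i₀ ∧ m = 0 then (1 : ℝ) else 0) j m s +
          Y j m s) i n t -
        quadTerm 1 α (fun j m (_ : ℝ) => if j = i₀ ∧ m = 0 then (1 : ℝ) else 0) i n t -
        quadTerm 1 α Y i n t = d i n * Y i n t)
    (hb : ∀ j : Fin 4, j ≠ i₀ → j ≠ i₁ → α i₁ i₁ j (0, 0, 0) = 0)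
    (X : Fin 4 → ℤ → ℝ → ℝ) (t : ℝ) (hX : ∀ i n, n ≠ 0 → n ≠ 1 → X i n t = 0)
    (hX1 : ∀ i, i ≠ i₀ → X i 1 t = 0) :
    quadTerm 1 α X i₁ 0 t =
      X i₁ 0 t * (d i₁ 0 * X i₀ 0 t - α i₁ i₁ i₀ (0, 0, 1) * X i₀ 1 t) := by
  obtain ⟨-, -, -, nf4, -, -, -, -, nf9⟩ :=
    HeteroclinicTriggerChain.stub_normal_form α i₀ d hsym hcanc hpure hsad
  have m000 : ((0 : ℤ), (0 : ℤ), (0 : ℤ)) ∈ shiftSet := by decide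
  -- the same-shell trigger/junk couplings vanish with the trigger self-interaction
  have hjunk : ∀ j : Fin 4, j ≠ i₀ → j ≠ i₁ →
      α i₁ j i₁ (0, 0, 0) = 0 ∧ α j i₁ i₁ (0, 0, 0) = 0 := by
    intro j hj0 hj1
    have c := hcanc i₁ i₁ j 0 0 0 m000
    have s := hsym i₁ j i₁ 0 0 0 m000
    have hz := hb j hj0 hj1
    constructor <;> linarith
  rw [htcNF_quadTerm_expand, htcCA_gain_zero, one_mul]
  have hpump : ∑ a : Fin 4, ∑ b : Fin 4, α a b i₁ (0, 0, 1) * (X a (0 - 1) t * X b (0 - 1) t) = 0 := by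
    refine Finset.sum_eq_zero fun a _ => Finset.sum_eq_zero fun b _ => ?_
    rw [hX a (0 - 1) (by norm_num) (by norm_num), zero_mul, mul_zero]
  rw [hpump, mul_zero, add_zero]
  have hmain : ∀ a b : Fin 4,
      α a b i₁ (0, 0, 0) * (X a 0 t * X b 0 t) + α a b i₁ (1, 0, 0) * (X a (0 + 1) t * X b 0 t) +
        α a b i₁ (0, 1, 0) * (X a 0 t * X b (0 + 1) t) =
      (if a = i₀ ∧ b = i₁ then
        α i₀ i₁ i₁ (0, 0, 0) * (X i₀ 0 t * X i₁ 0 t) + α i₀ i₁ i₁ (1, 0, 0) * (X i₀ 1 t * X i₁ 0 t)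
        else 0) +
      (if a = i₁ ∧ b = i₀ then
        α i₁ i₀ i₁ (0, 0, 0) * (X i₁ 0 t * X i₀ 0 t) + α i₁ i₀ i₁ (0, 1, 0) * (X i₁ 0 t * X i₀ 1 t)
        else 0) := by
    intro a b
    rw [zero_add]
    by_cases ha1 : a = i₁
    · -- a = i₁ : only the pair (i₁, i₀) contributes
      rw [ha1, if_neg (show ¬(i₁ = i₀ ∧ b = i₁) from fun h => hne h.1.symm), zero_add,
        hX1 i₁ (Ne.symm hne), zero_mul, mul_zero, add_zero]
      by_cases hb0 : b = i₀
      · rw [hb0, if_pos (show i₁ = i₁ ∧ i₀ = i₀ from ⟨rfl, rfl⟩)]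
      · rw [if_neg (show ¬(i₁ = i₁ ∧ b = i₀) from fun h => hb0 h.2), hX1 b hb0, mul_zero, mul_zero,
          add_zero]
        by_cases hb1 : b = i₁
        · rw [hb1, hpar i₁ i₁ i₁ (0, 0, 0) (by simp [Xor]), zero_mul]
        · rw [(hjunk b hb0 hb1).1, zero_mul]
    · by_cases ha0 : a = i₀
      · -- a = i₀ : only the pair (i₀, i₁) contributes
        rw [ha0, if_neg (show ¬(i₀ = i₁ ∧ b = i₀) from fun h => hne h.1)]
        by_cases hb1 : b = i₁
        · rw [hb1, if_pos (show i₀ = i₀ ∧ i₁ = i₁ from ⟨rfl, rfl⟩), hX1 i₁ (Ne.symm hne), mul_zero,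
            mul_zero, add_zero]
        · rw [if_neg (show ¬(i₀ = i₀ ∧ b = i₁) from fun h => hb1 h.2), add_zero,
            hpar i₀ b i₁ (0, 0, 0) (by simp [Xor, hne, hb1]),
            hpar i₀ b i₁ (1, 0, 0) (by simp [Xor, hne, hb1]),
            hpar i₀ b i₁ (0, 1, 0) (by simp [Xor, hne, hb1]), zero_mul, zero_mul, zero_mul, add_zero,
            add_zero]
      · -- a is a junk mode
        rw [if_neg (show ¬(a = i₀ ∧ b = i₁) from fun h => ha0 h.1),
          if_neg (show ¬(a = i₁ ∧ b = i₀) from fun h => ha1 h.1), add_zero, hX1 a ha0, zero_mul,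
          mul_zero, add_zero]
        by_cases hb1 : b = i₁
        · rw [hb1, (hjunk a ha0 ha1).2, zero_mul, zero_add, hX1 i₁ (Ne.symm hne), mul_zero, mul_zero]
        · rw [hpar a b i₁ (0, 0, 0) (by simp [Xor, ha1, hb1]),
            hpar a b i₁ (0, 1, 0) (by simp [Xor, ha1, hb1]), zero_mul, zero_mul, add_zero]
  rw [Finset.sum_congr rfl fun a _ => Finset.sum_congr rfl fun b _ => hmain a b]
  simp only [Finset.sum_add_distrib]
  rw [htcCA_sum_sum_ite_pair, htcCA_sum_sum_ite_pair]
  have s0 := hsym i₁ i₀ i₁ 0 0 0 m000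
  obtain ⟨-, h100, h010, -⟩ := nf9 i₁
  rw [nf4 i₁, h100, h010, s0]
  ring

/-- **Non-trigger rows on a junk-free family.** Same setting; if the family charges no junk mode at
shell `0` (`X j 0 t = 0` for `j ∉ {i₀,i₁}`), every non-trigger mode `j ≠ i₁` (the junk modes, and the
carrier itself) is forced at shells `0` and `1` only by the trigger's self-interaction:
`quadTerm 1 α X j 0 t = α i₁ i₁ j (0,0,0) · u²` and `quadTerm 1 α X j 1 t = α i₁ i₁ j (0,0,1) · u²`
(for `j = i₀` these are the carrier drain `-e·u²` and the receiver pump `g·u²`). [this file] -/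
theorem htcCA_quadTerm_junk (α : Fin 4 → Fin 4 → Fin 4 → ℤ × ℤ × ℤ → ℝ) (i₀ i₁ : Fin 4)
    (d : Fin 4 → ℤ → ℝ) (hne : i₀ ≠ i₁)
    (hsym : IsSymmetricCoeff α) (hcanc : IsCancellingCoeff α)
    (hpure : ∀ X : Fin 4 → ℤ → ℝ → ℝ, (∀ i n t, i ≠ i₀ → X i n t = 0) →
      ∀ i n t, quadTerm 1 α X i n t = 0)
    (hpar : ∀ (j₁ j₂ j₃ : Fin 4) (μ : ℤ × ℤ × ℤ), Xor (Xor (j₁ = i₁) (j₂ = i₁)) (j₃ = i₁) →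
      α j₁ j₂ j₃ μ = 0)
    (hsad : ∀ (Y : Fin 4 → ℤ → ℝ → ℝ) (i : Fin 4) (n : ℤ) (t : ℝ),
      quadTerm 1 α (fun j m s => (fun j m (_ : ℝ) => if j = i₀ ∧ m = 0 then (1 : ℝ) else 0) j m s +
          Y j m s) i n t -
        quadTerm 1 α (fun j m (_ : ℝ) => if j = i₀ ∧ m = 0 then (1 : ℝ) else 0) i n t -
        quadTerm 1 α Y i n t = d i n * Y i n t)
    (X : Fin 4 → ℤ → ℝ → ℝ) (t : ℝ) (hX : ∀ i n, n ≠ 0 → n ≠ 1 → X i n t = 0)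
    (hX1 : ∀ i, i ≠ i₀ → X i 1 t = 0) (hXj : ∀ j, j ≠ i₀ → j ≠ i₁ → X j 0 t = 0)
    (j : Fin 4) (hj1 : j ≠ i₁) :
    quadTerm 1 α X j 0 t = α i₁ i₁ j (0, 0, 0) * X i₁ 0 t ^ 2 ∧
      quadTerm 1 α X j 1 t = α i₁ i₁ j (0, 0, 1) * X i₁ 0 t ^ 2 := by
  obtain ⟨nf1, -, -, -, -, -, -, -, -⟩ :=
    HeteroclinicTriggerChain.stub_normal_form α i₀ d hsym hcanc hpure hsad
  -- the shell-`0` pair sum of any row `i ≠ i₁` against a shift `μ` reduces to the trigger square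
  have hpair : ∀ (μ : ℤ × ℤ × ℤ), μ ∈ shiftSet →
      ∑ a : Fin 4, ∑ b : Fin 4, α a b j μ * (X a 0 t * X b 0 t) = α i₁ i₁ j μ * X i₁ 0 t ^ 2 := by
    intro μ hμ
    have key : ∀ a b : Fin 4, α a b j μ * (X a 0 t * X b 0 t) =
        if a = i₁ ∧ b = i₁ then α i₁ i₁ j μ * X i₁ 0 t ^ 2 else 0 := by
      intro a b
      by_cases ha1 : a = i₁
      · rw [ha1]
        by_cases hb1 : b = i₁
        · rw [hb1, if_pos ⟨rfl, rfl⟩]; ring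
        · rw [if_neg (fun h => hb1 h.2)]
          by_cases hb0 : b = i₀
          · rw [hb0, hpar i₁ i₀ j μ (by simp [Xor, hne, hj1]), zero_mul]
          · rw [hXj b hb0 hb1, mul_zero, mul_zero]
      · rw [if_neg (fun h => ha1 h.1)]
        by_cases ha0 : a = i₀
        · rw [ha0]
          by_cases hb1 : b = i₁
          · rw [hb1, hpar i₀ i₁ j μ (by simp [Xor, hne, hj1]), zero_mul]
          · by_cases hb0 : b = i₀
            · rw [hb0, nf1 j μ hμ, zero_mul]
            · rw [hXj b hb0 hb1, mul_zero, mul_zero]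
        · rw [hXj a ha0 ha1, zero_mul, mul_zero]
    rw [Finset.sum_congr rfl fun a _ => Finset.sum_congr rfl fun b _ => key a b,
      htcCA_sum_sum_ite_pair]
  constructor
  · rw [htcNF_quadTerm_expand, htcCA_gain_zero, one_mul]
    have hpump : ∑ a : Fin 4, ∑ b : Fin 4, α a b j (0, 0, 1) * (X a (0 - 1) t * X b (0 - 1) t) = 0 := by
      refine Finset.sum_eq_zero fun a _ => Finset.sum_eq_zero fun b _ => ?_
      rw [hX a (0 - 1) (by norm_num) (by norm_num), zero_mul, mul_zero]
    rw [hpump, mul_zero, add_zero]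
    have hback : ∀ a b : Fin 4, α a b j (1, 0, 0) * (X a (0 + 1) t * X b 0 t) +
        α a b j (0, 1, 0) * (X a 0 t * X b (0 + 1) t) = 0 := by
      intro a b
      rw [zero_add]
      have h1 : α a b j (1, 0, 0) * (X a 1 t * X b 0 t) = 0 := by
        by_cases ha0 : a = i₀
        · rw [ha0]
          by_cases hb1 : b = i₁
          · rw [hb1, hpar i₀ i₁ j (1, 0, 0) (by simp [Xor, hne, hj1]), zero_mul]
          · by_cases hb0 : b = i₀
            · rw [hb0, nf1 j (1, 0, 0) (by decide), zero_mul]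
            · rw [hXj b hb0 hb1, mul_zero, mul_zero]
        · rw [hX1 a ha0, zero_mul, mul_zero]
      have h2 : α a b j (0, 1, 0) * (X a 0 t * X b 1 t) = 0 := by
        by_cases hb0 : b = i₀
        · rw [hb0]
          by_cases ha1 : a = i₁
          · rw [ha1, hpar i₁ i₀ j (0, 1, 0) (by simp [Xor, hne, hj1]), zero_mul]
          · by_cases ha0 : a = i₀
            · rw [ha0, nf1 j (0, 1, 0) (by decide), zero_mul]
            · rw [hXj a ha0 ha1, zero_mul, mul_zero]
        · rw [hX1 b hb0, mul_zero, mul_zero]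
      rw [h1, h2, add_zero]
    have hsplit : ∑ a : Fin 4, ∑ b : Fin 4,
        (α a b j (0, 0, 0) * (X a 0 t * X b 0 t) + α a b j (1, 0, 0) * (X a (0 + 1) t * X b 0 t) +
          α a b j (0, 1, 0) * (X a 0 t * X b (0 + 1) t)) =
        ∑ a : Fin 4, ∑ b : Fin 4, α a b j (0, 0, 0) * (X a 0 t * X b 0 t) := by
      refine Finset.sum_congr rfl fun a _ => Finset.sum_congr rfl fun b _ => ?_
      rw [add_assoc, hback a b, add_zero]
    rw [hsplit, hpair (0, 0, 0) (by decide)]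
  · rw [htcNF_quadTerm_expand, htcCA_gain_one_sub_one, one_mul]
    have htop : ∑ a : Fin 4, ∑ b : Fin 4,
        (α a b j (0, 0, 0) * (X a 1 t * X b 1 t) + α a b j (1, 0, 0) * (X a (1 + 1) t * X b 1 t) +
          α a b j (0, 1, 0) * (X a 1 t * X b (1 + 1) t)) = 0 := by
      refine Finset.sum_eq_zero fun a _ => Finset.sum_eq_zero fun b _ => ?_
      rw [hX a (1 + 1) (by norm_num) (by norm_num), hX b (1 + 1) (by norm_num) (by norm_num),
        zero_mul, mul_zero, mul_zero, mul_zero, add_zero, add_zero]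
      by_cases ha : a = i₀
      · rw [ha]
        by_cases hb : b = i₀
        · rw [hb, nf1 j (0, 0, 0) (by decide), zero_mul]
        · rw [hX1 b hb, mul_zero, mul_zero]
      · rw [hX1 a ha, zero_mul, mul_zero]
    rw [htop, mul_zero, zero_add]
    simp only [sub_self]
    exact hpair (0, 0, 1) (by decide)

/-- **The boundary cubic sums vanish** on a family supported on shell `0` and the receiver `(i₀,1)` when
`α i₀ i₀ · (0,0,0) = 0` (purity): `topSum 1 α X (-1) t = 0` (no amplitude at shell `-1`) and
`topSum 1 α X 1 t = 0` (at shell `1` only the pure receiver, at shell `2` nothing). [this file] -/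
theorem htcCA_topSum_eq_zero (α : Fin 4 → Fin 4 → Fin 4 → ℤ × ℤ × ℤ → ℝ) (i₀ : Fin 4)
    (h000 : ∀ i : Fin 4, α i₀ i₀ i (0, 0, 0) = 0)
    (X : Fin 4 → ℤ → ℝ → ℝ) (t : ℝ) (hX : ∀ i n, n ≠ 0 → n ≠ 1 → X i n t = 0)
    (hX1 : ∀ i, i ≠ i₀ → X i 1 t = 0) :
    topSum 1 α X (-1) t = 0 ∧ topSum 1 α X 1 t = 0 := by
  constructor
  · unfold topSum
    refine Finset.sum_eq_zero fun a _ => Finset.sum_eq_zero fun b _ =>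
      Finset.sum_eq_zero fun c _ => ?_
    rw [hX c (-1) (by norm_num) (by norm_num)]
    ring
  · unfold topSum
    refine Finset.sum_eq_zero fun a _ => Finset.sum_eq_zero fun b _ =>
      Finset.sum_eq_zero fun c _ => ?_
    rw [hX a (1 + 1) (by norm_num) (by norm_num), hX b (1 + 1) (by norm_num) (by norm_num)]
    by_cases ha : a = i₀
    · rw [ha]
      by_cases hb : b = i₀
      · rw [hb, h000 c]; ring
      · rw [hX1 b hb]; ring
    · rw [hX1 a ha]; ring

/-- **Two-shell energy identity.** For a CANCELLING table with `α i₀ i₀ · (0,0,0) = 0` and a family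
supported on shell `0` and the receiver `(i₀,1)`, the summed energy nonlinearity of the two shells
vanishes: `∑ᵢ quadTerm·X` at shell `0` plus the same at shell `1` is `0` (the cubic sums telescope to the
boundary sums, which vanish). Hence the total energy `∑ᵢ X_{i,0}² + X_{i₀,1}²` is conserved along exact
flows of this shape. [this file] -/
theorem htcCA_energy_identity (α : Fin 4 → Fin 4 → Fin 4 → ℤ × ℤ × ℤ → ℝ) (i₀ : Fin 4)
    (hcanc : IsCancellingCoeff α) (h000 : ∀ i : Fin 4, α i₀ i₀ i (0, 0, 0) = 0)
    (X : Fin 4 → ℤ → ℝ → ℝ) (t : ℝ) (hX : ∀ i n, n ≠ 0 → n ≠ 1 → X i n t = 0)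
    (hX1 : ∀ i, i ≠ i₀ → X i 1 t = 0) :
    ∑ i : Fin 4, quadTerm 1 α X i 0 t * X i 0 t + ∑ i : Fin 4, quadTerm 1 α X i 1 t * X i 1 t = 0 := by
  obtain ⟨hm1, hp1⟩ := htcCA_topSum_eq_zero α i₀ h000 X t hX hX1
  rw [sum_quadTerm_mul, sum_quadTerm_mul, botSum_eq_neg_topSum 1 hcanc,
    botSum_eq_neg_topSum 1 hcanc]
  have e0 : ((0 : ℤ) - 1) = -1 := by norm_num
  have e1 : ((1 : ℤ) - 1) = 0 := by norm_num
  rw [e0, e1, hm1, hp1]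
  ring

end Summit.NavierStokesRegularity.NavierStokesRegularity.Theorems

end
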